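import Summits.Ventures.Crystal3D.Theorems.StickyWulffConstantGenericWallFloorConeCertificateRhoPerBall
import HarnessLib

/-!
# FAN cone certificates: a fan of tangent test directions per free ball (×1.28–1.39 larger tube radii) — part A (geometry, format, bookkeeping)

Helper for `stmt-Ventures-19480` (E1 inside-tube half; lit g12, LIT §36(D)).  The landed `ConeCert`
tests the first-order margin in the four signed directions `±τ₀, ±τ₁` of an integer orthogonal tangent
frame and loses the covering constant `1/√2` (every tangent `w` is within `45°` of one of them).  A
`FanCert` carries, per free ball, LP certificates for a FAN of integer directions
`±α_k τ₀ ± β_k τ₁`, `(α_k, β_k)` running from `(1,0)` to `(0,1)` with increasing slope; every tangent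
`w` lies in the cone of two CONSECUTIVE signed directions (`fan_coeffs`: sign flags put `w` in the first
quadrant, a discrete intermediate-value step finds the sector), and for the better of the two,
`cover_two` — purely algebraic: `W = xP + yQ`, `x, y ≥ 0` ⇒ `max(Ŵ·P̂, Ŵ·Q̂)² ≥ (1 + P̂·Q̂)/2` — gives
`Cd ‖w‖² ‖D‖² ≤ Cn ⟪w, D⟫²` with the certificate's rational covering constant `c² ≥ Cd/Cn`, checked in
integers per consecutive pair (`(2Cd − Cn)² |D_k|²|D_k'|² ≤ Cn² (D_k·D_k')²`, `D_k·D_l = α_kα_l|τ₀|² +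
β_kβ_l|τ₁|²`).  Own contacts are in the OBSTACLE-general form `2·slot·P = P·P` (unit own balls:
`P·P = N`), second-order weight `B_N = Σ_own λ (P·P) + 6N Λ_free`, and the per-ball radius check is
`ρ_i² (Cn B_N² + 4N Cd r² |D|²) ≤ 16 N Cd r² |D|²` for every fan direction `D` at ball `i`
(`FanCert.rhoCheckAt`; for `Cn/Cd = 2` and an orthogonal pair this is the landed `rhoCheck`).
THEOREMS: `FanCert.eq_slots_rhoAt` / `eq_slots_rhoAt_dist` (check ∧ ∀ i, rhoCheckAt i (p i) q ⇒ every
admissible completion with ball `i` within chord `p i / q` of slot `i` IS the slot configuration),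
`FanCert.eq_slotSet_of_slotMatched` (finset form in the `SlotMatched` currency of
`…ConeCertificateRhoPerBall`, feeding `exactOnly_of_slotTube_and_exhaustion`).
NUMBERS (exact, `cert/gencert_fan.py`, K = 12 directions, Cd/Cn = 9866/10000; kernel-checked data files
`…ConeCertFan{Fcc55,Hcp451,Hcp1743,Hcp1735,Hcp615,Hcp719,Hcp1739}`), per-ball radii FAN vs the landed per-ball
`…ConeCertRhoAt*` (orthogonal pair): C12-55 (0.104, 0.193, 0.193, 0.104, 0.193, 0.193, 0.280) vs (0.074, 0.141, 0.141,
0.074, 0.141, 0.141, 0.201); A12-451 (0.144, 0.152, 0.152, 0.144, 0.147, 0.135, 0.135) vs (0.108, 0.115, 0.115, 0.108,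
0.106, 0.096, 0.133); A12-1743 (0.393, 0.393, 0.204, 0.204) vs (0.282, 0.282, 0.145, 0.167); A12-1735 (0.241, 0.280,
0.256, 0.175, 0.175) vs (0.175, 0.201, 0.199, 0.127, 0.132); A12-615 (0.280, 0.280, 0.153, 0.153, 0.153, 0.153) vs
(0.201, 0.201, 0.114, 0.114, 0.114, 0.125); A12-719 min 0.161 vs 0.119; A12-1739 min 0.204 vs 0.145 (×1.35–1.41 on
the binding ball).  lit g12 (crystal3d-full; HOME/cf-lit/lean/conecert-fan/).

WHAT THIS IS NOT: the exhaustion outside the tube (eng lineage B / cf-p2 lineage A); rung F-C1 not moved.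
-/

noncomputable section

namespace Summit.Ventures.Crystal3D.Theorems

open Finset Literature.Geometry.DiscreteGeometry
open scoped RealInnerProductSpace

/-- Active OBSTACLE (or own) contact, second order: if `⟪s, p⟫ = ‖p‖²/2` (active at the slot) and
`⟪x, p⟫ ≤ ‖p‖²/2` (no overlap) then the tangent part `v = (x − s) + (‖x − s‖²/2) s` satisfies
`⟪v, p⟫ ≤ ‖x − s‖² ‖p‖² / 4`. -/
theorem inner_tangentPart_obstacle_le {E : Type*} [NormedAddCommGroup E] [InnerProductSpace ℝ E]
    {s x p : E} (hsp : ⟪s, p⟫ = ‖p‖ ^ 2 / 2) (hxp : ⟪x, p⟫ ≤ ‖p‖ ^ 2 / 2) :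
    ⟪(x - s) + (‖x - s‖ ^ 2 / 2) • s, p⟫ ≤ ‖x - s‖ ^ 2 * ‖p‖ ^ 2 / 4 := by
  rw [inner_add_left, real_inner_smul_left, inner_sub_left, hsp]
  nlinarith [sq_nonneg ‖x - s‖, sq_nonneg ‖p‖]

/-! ### Geometric lemmas for FAN certificates -/

/-- **Two-direction covering (algebraic, no trigonometry).**  If `W = x P + y Q` with `x, y ≥ 0`
(`W` in the cone of `P, Q`) and `⟪P, Q⟫ ≥ 0`, then for `D` = the better of `P, Q`:
`⟪W, D⟫ ≥ 0` and `‖W‖² ‖D‖² (‖P‖‖Q‖ + ⟪P,Q⟫) ≤ 2 ⟪W, D⟫² ‖P‖‖Q‖` — i.e. the angle between `W` and `D`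
is at most half the angle between `P` and `Q` (`cos² ≥ (1 + cos∠(P,Q))/2`). -/
theorem cover_two {E : Type*} [NormedAddCommGroup E] [InnerProductSpace ℝ E] {P Q W : E} {x y : ℝ}
    (hP : P ≠ 0) (hQ : Q ≠ 0) (hx : 0 ≤ x) (hy : 0 ≤ y) (hW : W = x • P + y • Q) (hPQ : 0 ≤ ⟪P, Q⟫) :
    ∃ D : E, (D = P ∨ D = Q) ∧ 0 ≤ ⟪W, D⟫ ∧
      ‖W‖ ^ 2 * ‖D‖ ^ 2 * (‖P‖ * ‖Q‖ + ⟪P, Q⟫) ≤ 2 * ⟪W, D⟫ ^ 2 * (‖P‖ * ‖Q‖) := by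
  set p := ‖P‖ with hp
  set q := ‖Q‖ with hq
  set c := ⟪P, Q⟫ with hc
  have hp0 : 0 < p := norm_pos_iff.2 hP
  have hq0 : 0 < q := norm_pos_iff.2 hQ
  have hA : ⟪W, P⟫ = x * p ^ 2 + y * c := by
    rw [hW, inner_add_left, real_inner_smul_left, real_inner_smul_left, real_inner_self_eq_norm_sq,
      real_inner_comm]
  have hB : ⟪W, Q⟫ = x * c + y * q ^ 2 := by
    rw [hW, inner_add_left, real_inner_smul_left, real_inner_smul_left, real_inner_self_eq_norm_sq]
  have hWW : ‖W‖ ^ 2 = x * ⟪W, P⟫ + y * ⟪W, Q⟫ := by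
    have : ‖W‖ ^ 2 = ⟪W, W⟫ := (real_inner_self_eq_norm_sq W).symm
    rw [this]
    conv_lhs => rw [hW]; rw [inner_add_right, real_inner_smul_right, real_inner_smul_right]
    rw [← hW]
  set A := ⟪W, P⟫ with hAdef
  set B := ⟪W, Q⟫ with hBdef
  have hA0 : 0 ≤ A := by rw [hA]; positivity
  have hB0 : 0 ≤ B := by rw [hB]; positivity
  have hcpq : c ≤ p * q := by
    have := real_inner_le_norm P Q; rw [← hc, ← hp, ← hq] at this; exact this
  -- key identity: A/p + B/q = (x p + y q)(1 + c/(p q)), i.e. A q + B p = (x p + y q)(p q + c)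
  have hkey : A * q + B * p = (x * p + y * q) * (p * q + c) := by rw [hA, hB]; ring
  by_cases hcase : B * p ≤ A * q
  · -- D = P
    refine ⟨P, Or.inl rfl, hA0, ?_⟩
    -- ‖W‖² ≤ (A/p)(x p + y q)  and  (x p + y q)(p q + c) ≤ 2 A q
    have h1 : ‖W‖ ^ 2 * p ≤ A * (x * p + y * q) := by
      rw [hWW]; nlinarith [mul_nonneg hy (sub_nonneg.2 hcase)]
    have h2 : (x * p + y * q) * (p * q + c) ≤ 2 * A * q := by nlinarith
    have h3 : 0 ≤ x * p + y * q := by positivity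
    have h4 : 0 ≤ p * q + c := by positivity
    -- goal: ‖W‖² p² (pq + c) ≤ 2 A² (p q)
    rw [← hp]
    have : ‖W‖ ^ 2 * p ^ 2 * (p * q + c) ≤ 2 * A ^ 2 * (p * q) := by
      calc ‖W‖ ^ 2 * p ^ 2 * (p * q + c) = (‖W‖ ^ 2 * p) * (p * (p * q + c)) := by ring
        _ ≤ (A * (x * p + y * q)) * (p * (p * q + c)) :=
            mul_le_mul_of_nonneg_right h1 (by positivity)
        _ = A * p * ((x * p + y * q) * (p * q + c)) := by ring
        _ ≤ A * p * (2 * A * q) := mul_le_mul_of_nonneg_left h2 (by positivity)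
        _ = 2 * A ^ 2 * (p * q) := by ring
    exact this
  · -- D = Q
    have hcase' : A * q ≤ B * p := (not_le.mp hcase).le
    refine ⟨Q, Or.inr rfl, hB0, ?_⟩
    have h1 : ‖W‖ ^ 2 * q ≤ B * (x * p + y * q) := by
      rw [hWW]; nlinarith [mul_nonneg hx (sub_nonneg.2 hcase')]
    have h2 : (x * p + y * q) * (p * q + c) ≤ 2 * B * p := by nlinarith
    rw [← hq]
    have : ‖W‖ ^ 2 * q ^ 2 * (p * q + c) ≤ 2 * B ^ 2 * (p * q) := by
      calc ‖W‖ ^ 2 * q ^ 2 * (p * q + c) = (‖W‖ ^ 2 * q) * (q * (p * q + c)) := by ring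
        _ ≤ (B * (x * p + y * q)) * (q * (p * q + c)) :=
            mul_le_mul_of_nonneg_right h1 (by positivity)
        _ = B * q * ((x * p + y * q) * (p * q + c)) := by ring
        _ ≤ B * q * (2 * B * p) := mul_le_mul_of_nonneg_left h2 (by positivity)
        _ = 2 * B ^ 2 * (p * q) := by ring
    exact this

/-- Frame decomposition: a vector orthogonal to `S` is the combination of the other two vectors of an
orthogonal frame `(S, T₀, T₁)` of `ℝ³` with coefficients `⟪w, T_a⟫/‖T_a‖²`. -/
theorem eq_frame_combination {S T0 T1 w : (EuclideanSpace ℝ (Fin 3))} (hS : S ≠ 0) (h0 : T0 ≠ 0) (h1 : T1 ≠ 0)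
    (hS0 : ⟪S, T0⟫ = 0) (hS1 : ⟪S, T1⟫ = 0) (h01 : ⟪T0, T1⟫ = 0) (hw : ⟪w, S⟫ = 0) :
    w = (⟪w, T0⟫ / ‖T0‖ ^ 2) • T0 + (⟪w, T1⟫ / ‖T1‖ ^ 2) • T1 := by
  have hn0 : ‖T0‖ ^ 2 ≠ 0 := by positivity
  have hn1 : ‖T1‖ ^ 2 ≠ 0 := by positivity
  set w' := w - ((⟪w, T0⟫ / ‖T0‖ ^ 2) • T0 + (⟪w, T1⟫ / ‖T1‖ ^ 2) • T1) with hw'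
  have h10 : ⟪T1, T0⟫ = 0 := by rw [real_inner_comm]; exact h01
  have hz : w' = 0 := by
    refine eq_zero_of_orthogonal_three hS h0 h1 hS0 hS1 h01 ?_ ?_ ?_
    · have hT0S : ⟪T0, S⟫ = 0 := by rw [real_inner_comm]; exact hS0
      have hT1S : ⟪T1, S⟫ = 0 := by rw [real_inner_comm]; exact hS1
      rw [hw', inner_sub_left, inner_add_left, real_inner_smul_left, real_inner_smul_left, hw,
        hT0S, hT1S]; ring
    · rw [hw', inner_sub_left, inner_add_left, real_inner_smul_left, real_inner_smul_left,
        real_inner_self_eq_norm_sq, h10]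
      field_simp; ring
    · rw [hw', inner_sub_left, inner_add_left, real_inner_smul_left, real_inner_smul_left, h01,
        real_inner_self_eq_norm_sq]
      field_simp; ring
  rw [hw'] at hz
  exact (sub_eq_zero.1 hz)

/-- Discrete intermediate value step: a finite sequence `f 0 ≥ 0`, `f (K-1) ≤ 0` (`K ≥ 2`) has a
consecutive pair `f k ≥ 0 ≥ f (k+1)`. -/
theorem exists_consecutive_sign_change {K : ℕ} (hK : 2 ≤ K) (f : ℕ → ℝ) (h0 : 0 ≤ f 0)
    (hlast : f (K - 1) ≤ 0) : ∃ k, k + 1 < K ∧ 0 ≤ f k ∧ f (k + 1) ≤ 0 := by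
  classical
  have hex : ∃ n, 1 ≤ n ∧ f n ≤ 0 := ⟨K - 1, by omega, hlast⟩
  let j := Nat.find hex
  have hj : 1 ≤ j ∧ f j ≤ 0 := Nat.find_spec hex
  have hjle : j ≤ K - 1 := Nat.find_le ⟨by omega, hlast⟩
  refine ⟨j - 1, by omega, ?_, ?_⟩
  · by_cases hj1 : j = 1
    · have : j - 1 = 0 := by omega
      rw [this]; exact h0
    · have hmin := Nat.find_min hex (m := j - 1) (by omega)
      push Not at hmin
      exact (hmin (by omega)).le
  · have : j - 1 + 1 = j := by omega
    rw [this]; exact hj.2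

/-! ### The FAN certificate format -/

/-- An integer certificate for the first-order cone margin with a FAN of tangent test directions
`±α_k τ₀ ± β_k τ₁` per free ball (see the module docstring). -/
structure FanCert (m : ℕ) where
  N : ℕ
  slot : Fin m → (Fin 3 → ℤ)
  nO : ℕ
  ownBall : Fin nO → Fin m
  ownVec : Fin nO → (Fin 3 → ℤ)
  nF : ℕ
  freeA : Fin nF → Fin m
  freeB : Fin nF → Fin m
  tau : Fin m → Fin 2 → (Fin 3 → ℤ)
  K : ℕ
  alpha : Fin K → ℕ
  beta : Fin K → ℕ
  lamO : Fin m → Fin K → Bool → Bool → Fin nO → ℕ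
  lamF : Fin m → Fin K → Bool → Bool → Fin nF → ℕ
  r : Fin m → Fin K → Bool → Bool → ℕ
  mu : Fin m → Fin K → Bool → Bool → Fin m → ℤ
  Cn : ℕ
  Cd : ℕ

namespace FanCert

variable {m : ℕ} (C : FanCert m)

/-- The fan direction `k` at ball `i` with sign flags `(s₀, s₁)`: `±α_k τ₀(i) ± β_k τ₁(i)`. -/
def dir (i : Fin m) (k : Fin C.K) (s0 s1 : Bool) : Fin 3 → ℤ :=
  (ConeCert.sgn s0 * (C.alpha k : ℤ)) • C.tau i 0 + (ConeCert.sgn s1 * (C.beta k : ℤ)) • C.tau i 1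

/-- `⟪D_k, D_k'⟫` in the tangent metric of ball `i` (same sign flags): `α_k α_k' |τ₀|² + β_k β_k' |τ₁|²`. -/
def ddot (i : Fin m) (k k' : Fin C.K) : ℤ :=
  (C.alpha k : ℤ) * (C.alpha k' : ℤ) * dotInt (C.tau i 0) (C.tau i 0) +
    (C.beta k : ℤ) * (C.beta k' : ℤ) * dotInt (C.tau i 1) (C.tau i 1)

/-- The combined gradient at ball `i` of the weighted active constraints for `(i₀, k, s₀, s₁)`. -/
def grad (i₀ : Fin m) (k : Fin C.K) (s0 s1 : Bool) (i : Fin m) : Fin 3 → ℤ :=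
  (∑ c : Fin C.nO, if C.ownBall c = i then C.lamO i₀ k s0 s1 c • C.ownVec c else 0) +
    (∑ c : Fin C.nF, if C.freeA c = i then C.lamF i₀ k s0 s1 c • C.slot (C.freeB c) else 0) +
    ∑ c : Fin C.nF, if C.freeB c = i then C.lamF i₀ k s0 s1 c • C.slot (C.freeA c) else 0

/-- Second-order weight at integer scale (own/obstacle contacts with their own `P·P`):
`B_N = Σ_own λ (P·P) + 6 N Λ_free`. -/
def BN (i₀ : Fin m) (k : Fin C.K) (s0 s1 : Bool) : ℤ :=
  (∑ c : Fin C.nO, (C.lamO i₀ k s0 s1 c : ℤ) * dotInt (C.ownVec c) (C.ownVec c)) +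
    6 * (C.N : ℤ) * ∑ c : Fin C.nF, (C.lamF i₀ k s0 s1 c : ℤ)

/-- Validity check of a fan certificate (one `decide`): geometry of slots / own (or obstacle) / free
contacts and tangent frames as in `ConeCert.checkObs`; the fan runs from `(1,0)` to `(0,1)` with
strictly increasing slope (`α_k β_k' > α_k' β_k` for consecutive `k, k'`); consecutive directions are
within the covering constant: `c_{kk'}² = (1 + D̂_k·D̂_k')/2 ≥ Cd/Cn` in the integer form
`2Cd ≤ Cn ∨ (2Cd − Cn)² |D_k|²|D_k'|² ≤ Cn² (D_k·D_k')²` at every ball; and the per-(i₀,k,s₀,s₁) identity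
`Σ_c λ_c ∇_i L_c = μ_i slot_i + [i = i₀] r · dir`. -/
def check (C : FanCert m) : Bool := decide (
  0 < C.N ∧ 2 ≤ C.K ∧ 0 < C.Cn ∧ 0 < C.Cd ∧
  (∀ i : Fin m, dotInt (C.slot i) (C.slot i) = C.N) ∧
  (∀ c : Fin C.nO, 2 * dotInt (C.slot (C.ownBall c)) (C.ownVec c) = dotInt (C.ownVec c) (C.ownVec c)) ∧
  (∀ c : Fin C.nF, C.freeA c ≠ C.freeB c ∧ 2 * dotInt (C.slot (C.freeA c)) (C.slot (C.freeB c)) = C.N) ∧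
  (∀ i : Fin m, C.slot i ≠ 0 ∧ C.tau i 0 ≠ 0 ∧ C.tau i 1 ≠ 0 ∧
    dotInt (C.slot i) (C.tau i 0) = 0 ∧ dotInt (C.slot i) (C.tau i 1) = 0 ∧
    dotInt (C.tau i 0) (C.tau i 1) = 0) ∧
  (∀ k : Fin C.K, (k.val = 0 → C.alpha k = 1 ∧ C.beta k = 0) ∧
    (k.val = C.K - 1 → C.alpha k = 0 ∧ C.beta k = 1)) ∧
  (∀ k k' : Fin C.K, k'.val = k.val + 1 →
    C.alpha k' * C.beta k < C.alpha k * C.beta k' ∧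
    (∀ i : Fin m, 2 * C.Cd ≤ C.Cn ∨
      (2 * (C.Cd : ℤ) - C.Cn) ^ 2 * C.ddot i k k * C.ddot i k' k' ≤ (C.Cn : ℤ) ^ 2 * (C.ddot i k k') ^ 2)) ∧
  (∀ i₀ : Fin m, ∀ k : Fin C.K, ∀ s0 s1 : Bool,
    0 < C.r i₀ k s0 s1 ∧
    (∀ i : Fin m, C.grad i₀ k s0 s1 i =
      C.mu i₀ k s0 s1 i • C.slot i + (if i = i₀ then (C.r i₀ k s0 s1 : ℤ) • C.dir i₀ k s0 s1 else 0))))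

/-- Per-ball radius check: `ρ_{i₀} = p/q` is admissible iff for every fan direction at `i₀`
`p² (Cn B_N² + 4 N Cd r² |D|²) ≤ 16 N Cd r² |D|² q²`. -/
def rhoCheckAt (C : FanCert m) (i₀ : Fin m) (p q : ℕ) : Bool := decide (
  0 < q ∧ 0 < p ∧
  (∀ k : Fin C.K, ∀ s0 s1 : Bool,
    (p : ℤ) ^ 2 * ((C.Cn : ℤ) * (C.BN i₀ k s0 s1) ^ 2 +
        4 * (C.N : ℤ) * C.Cd * (C.r i₀ k s0 s1 : ℤ) ^ 2 * dotInt (C.dir i₀ k s0 s1) (C.dir i₀ k s0 s1)) ≤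
      16 * (C.N : ℤ) * C.Cd * (C.r i₀ k s0 s1 : ℤ) ^ 2 * dotInt (C.dir i₀ k s0 s1) (C.dir i₀ k s0 s1) *
        (q : ℤ) ^ 2))

/-- The real slot vectors `s i = slot i / √N`. -/
def s (i : Fin m) : (EuclideanSpace ℝ (Fin 3)) := (Real.sqrt C.N)⁻¹ • intVec (C.slot i)

/-- The listed own/obstacle centres (real). -/
def ownSet : Finset (EuclideanSpace ℝ (Fin 3)) :=
  Finset.univ.image fun c : Fin C.nO => (Real.sqrt C.N)⁻¹ • intVec (C.ownVec c)

/-! ### Real-side bookkeeping -/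

/-- The certificate directions `s i` are unit vectors. -/
theorem norm_s_eq_one (i : Fin m) (hV : C.check = true) : ‖C.s i‖ = 1 := by
  unfold FanCert.check at hV
  obtain ⟨hN, -, -, -, hunit, -⟩ := of_decide_eq_true hV
  have hpos := (Real.sqrt_pos.2 (by exact_mod_cast hN) : (0:ℝ) < Real.sqrt C.N)
  have hsq : ‖intVec (C.slot i)‖ ^ 2 = (C.N : ℝ) := by
    rw [← real_inner_self_eq_norm_sq, inner_intVec]; exact_mod_cast hunit i
  have hn : ‖intVec (C.slot i)‖ = Real.sqrt C.N := by
    rw [← Real.sqrt_sq (norm_nonneg _), hsq]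
  rw [FanCert.s, norm_smul, norm_inv, Real.norm_of_nonneg hpos.le, hn, inv_mul_cancel₀ hpos.ne']

/-- Auxiliary (`inner_s_obs`). -/
theorem inner_s_obs (hN : 0 < C.N) (c : Fin C.nO)
    (h : 2 * dotInt (C.slot (C.ownBall c)) (C.ownVec c) = dotInt (C.ownVec c) (C.ownVec c)) :
    ⟪C.s (C.ownBall c), (Real.sqrt C.N)⁻¹ • intVec (C.ownVec c)⟫ =
      ‖(Real.sqrt C.N)⁻¹ • intVec (C.ownVec c)‖ ^ 2 / 2 := by
  have hpos := (Real.sqrt_pos.2 (by exact_mod_cast hN) : (0:ℝ) < Real.sqrt C.N)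
  have hsq : Real.sqrt (C.N : ℝ) ^ 2 = C.N := Real.sq_sqrt (by positivity)
  have hPP : ‖intVec (C.ownVec c)‖ ^ 2 = (dotInt (C.ownVec c) (C.ownVec c) : ℝ) := by
    rw [← real_inner_self_eq_norm_sq, inner_intVec]
  rw [FanCert.s, real_inner_smul_left, real_inner_smul_right, inner_intVec, norm_smul, norm_inv,
    Real.norm_of_nonneg hpos.le, mul_pow, inv_pow, hPP]
  have h' : (2 : ℝ) * (dotInt (C.slot (C.ownBall c)) (C.ownVec c) : ℝ) =
      (dotInt (C.ownVec c) (C.ownVec c) : ℝ) := by exact_mod_cast h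
  field_simp
  nlinarith [hsq, h']

/-- Inner product of the two free directions of a free pair is `1/2`. -/
theorem inner_freeA_freeB (c : Fin C.nF) (hN : 0 < C.N)
    (h : 2 * dotInt (C.slot (C.freeA c)) (C.slot (C.freeB c)) = C.N) :
    ⟪C.s (C.freeA c), C.s (C.freeB c)⟫ = 1 / 2 := by
  have hpos := (Real.sqrt_pos.2 (by exact_mod_cast hN) : (0:ℝ) < Real.sqrt C.N)
  have hsq : Real.sqrt (C.N : ℝ) ^ 2 = C.N := Real.sq_sqrt (by positivity)
  rw [FanCert.s, FanCert.s, real_inner_smul_left, real_inner_smul_right, inner_intVec]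
  have h' : (2 : ℝ) * (dotInt (C.slot (C.freeA c)) (C.slot (C.freeB c)) : ℝ) = C.N := by
    exact_mod_cast h
  field_simp
  nlinarith [hsq, h']

/-- Regrouping the weighted sum of linearised constraints ball by ball. -/
theorem sum_inner_grad (i₀ : Fin m) (k : Fin C.K) (s0 s1 : Bool) (v : Fin m → (EuclideanSpace ℝ (Fin 3))) :
    ∑ i : Fin m, ⟪v i, intVec (C.grad i₀ k s0 s1 i)⟫ =
      (∑ c : Fin C.nO, (C.lamO i₀ k s0 s1 c : ℝ) * ⟪v (C.ownBall c), intVec (C.ownVec c)⟫) +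
      ∑ c : Fin C.nF, (C.lamF i₀ k s0 s1 c : ℝ) *
        (⟪v (C.freeA c), intVec (C.slot (C.freeB c))⟫ +
          ⟪v (C.freeB c), intVec (C.slot (C.freeA c))⟫) := by
  classical
  have key : ∀ (n : ℕ) (ball : Fin n → Fin m) (vec : Fin n → (Fin 3 → ℤ)) (lam : Fin n → ℕ),
      ∑ i : Fin m, ⟪v i, intVec (∑ c : Fin n, if ball c = i then lam c • vec c else 0)⟫ =
        ∑ c : Fin n, (lam c : ℝ) * ⟪v (ball c), intVec (vec c)⟫ := by
    intro n ball vec lam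
    have : ∀ i : Fin m, ⟪v i, intVec (∑ c : Fin n, if ball c = i then lam c • vec c else 0)⟫ =
        ∑ c : Fin n, if ball c = i then (lam c : ℝ) * ⟪v i, intVec (vec c)⟫ else 0 := by
      intro i
      rw [intVec_sum, inner_sum]
      refine Finset.sum_congr rfl fun c _ => ?_
      split_ifs with h
      · rw [intVec_nsmul, real_inner_smul_right]
      · rw [intVec_zero, inner_zero_right]
    simp_rw [this]
    rw [Finset.sum_comm]
    refine Finset.sum_congr rfl fun c _ => ?_
    rw [Finset.sum_ite_eq Finset.univ (ball c)]
    simp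
  simp only [FanCert.grad, intVec_add, inner_add_right, Finset.sum_add_distrib]
  rw [key C.nO C.ownBall C.ownVec (C.lamO i₀ k s0 s1),
    key C.nF C.freeA (fun c => C.slot (C.freeB c)) (C.lamF i₀ k s0 s1),
    key C.nF C.freeB (fun c => C.slot (C.freeA c)) (C.lamF i₀ k s0 s1), add_assoc,
    ← Finset.sum_add_distrib]
  congr 1
  refine Finset.sum_congr rfl fun c _ => ?_
  ring

/-- The real fan direction: `intVec (dir i k s₀ s₁) = (±α) T₀ + (±β) T₁`. -/
theorem intVec_dir (i : Fin m) (k : Fin C.K) (s0 s1 : Bool) :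
    intVec (C.dir i k s0 s1) =
      ((ConeCert.sgn s0 : ℝ) * (C.alpha k : ℝ)) • intVec (C.tau i 0) +
        ((ConeCert.sgn s1 : ℝ) * (C.beta k : ℝ)) • intVec (C.tau i 1) := by
  rw [FanCert.dir, intVec_add, intVec_zsmul, intVec_zsmul]
  push_cast
  rfl

/-- `sgn b ^ 2 = 1` in `ℝ`. -/
theorem _root_.Summit.Ventures.Crystal3D.Theorems.sgn_sq_real (b : Bool) :
    ((ConeCert.sgn b : ℝ)) ^ 2 = 1 := by
  cases b <;> simp [ConeCert.sgn]

/-- `sgn b * sgn b = 1` in `ℝ`. -/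
theorem _root_.Summit.Ventures.Crystal3D.Theorems.sgn_mul_sgn_real (b : Bool) :
    (ConeCert.sgn b : ℝ) * (ConeCert.sgn b : ℝ) = 1 := by
  cases b <;> simp [ConeCert.sgn]

/-- `⟪D_k, D_k'⟫` (same signs) in reals equals `ddot`. -/
theorem inner_dir_dir {i : Fin m} (k k' : Fin C.K) (s0 s1 : Bool)
    (h01 : dotInt (C.tau i 0) (C.tau i 1) = 0) :
    ⟪intVec (C.dir i k s0 s1), intVec (C.dir i k' s0 s1)⟫ = (C.ddot i k k' : ℝ) := by
  have h10 : ⟪intVec (C.tau i 1), intVec (C.tau i 0)⟫ = 0 := by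
    rw [inner_intVec]; rw [show dotInt (C.tau i 1) (C.tau i 0) = dotInt (C.tau i 0) (C.tau i 1) by
      unfold dotInt; ring]; exact_mod_cast h01
  have h01' : ⟪intVec (C.tau i 0), intVec (C.tau i 1)⟫ = 0 := by rw [inner_intVec]; exact_mod_cast h01
  rw [C.intVec_dir, C.intVec_dir, inner_add_left, inner_add_right, inner_add_right,
    real_inner_smul_left, real_inner_smul_left, real_inner_smul_right, real_inner_smul_right,
    real_inner_smul_left, real_inner_smul_left, real_inner_smul_right, real_inner_smul_right,
    h01', h10, inner_intVec, inner_intVec, FanCert.ddot]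
  push_cast
  have e0 := sgn_mul_sgn_real s0
  have e1 := sgn_mul_sgn_real s1
  have : (ConeCert.sgn s0 : ℝ) * (C.alpha k : ℝ) * ((ConeCert.sgn s0 : ℝ) * (C.alpha k' : ℝ) *
      (dotInt (C.tau i 0) (C.tau i 0) : ℝ)) =
      ((ConeCert.sgn s0 : ℝ) * (ConeCert.sgn s0 : ℝ)) * ((C.alpha k : ℝ) * (C.alpha k' : ℝ) *
      (dotInt (C.tau i 0) (C.tau i 0) : ℝ)) := by ring
  have h2 : (ConeCert.sgn s1 : ℝ) * (C.beta k : ℝ) * ((ConeCert.sgn s1 : ℝ) * (C.beta k' : ℝ) *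
      (dotInt (C.tau i 1) (C.tau i 1) : ℝ)) =
      ((ConeCert.sgn s1 : ℝ) * (ConeCert.sgn s1 : ℝ)) * ((C.beta k : ℝ) * (C.beta k' : ℝ) *
      (dotInt (C.tau i 1) (C.tau i 1) : ℝ)) := by ring
  rw [mul_zero, mul_zero, mul_zero, mul_zero, add_zero, zero_add, this, h2, e0, e1, one_mul, one_mul]

end FanCert

end Summit.Ventures.Crystal3D.Theorems

end
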